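import Mathlib
import Summits.ValiantsHypothesis.ValiantsHypothesis.Theses.DivisionGap
import Summits.ValiantsHypothesis.ValiantsHypothesis.Theorems.ZeroOneTransfer.Negative.TopComponentFree
import Summits.ValiantsHypothesis.ValiantsHypothesis.Theorems.PerDivisionHard.Negative.LoadBearing
import Summits.ValiantsHypothesis.ValiantsHypothesis.Theorems.PerDivisionHard.Negative.VarsCounting
import Summits.ValiantsHypothesis.ValiantsHypothesis.Theorems.PerDivisionHard.Negative.BooleanShadow
import Summits.ValiantsHypothesis.ValiantsHypothesis.Theorems.PerDivisionHard.Negative.PlainBridge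
import Summits.ValiantsHypothesis.ValiantsHypothesis.Theorems.PerDivisionHard.Negative.PerSupportBound
import Literature.Computability.AlgebraicComplexity.ArithCircuitProofs
import Literature.Computability.AlgebraicComplexity.PermanentIrreducible
import Literature.Computability.AlgebraicComplexity.RealTauConjectureDepthFour

/-!
# Line `pair-descent-jss-endpoint` — checked skeleton for crux `PerDivisionHard`
(item `stmt-ValiantsHypothesis-5065`, route `DivisionGap`, H1)

Crux (FIXED, concluded BY NAME below):
`PerDivisionHard := ∀ c, ∃ n₀, ∀ n ≥ n₀, ∀ h : ℝ≥0[x_ij] (n × n), h ≠ 0 →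
  2 ^ ((Nat.log 2 n + c) ^ c) < L(per_n · h) + L(h)`, `L = complexity` over the semiring `ℝ≥0`.

## The line (idea card `Ideas/pair-descent-jss-endpoint.md`; TRIAGE-r1-{1,2,3}: pass, primary of
the merged face-descent family `≈ birkhoff-face-descent ≈ girth-face-rigidity`)

Degenerate the PAIR `(per·h, h)` along the normal fan of the Birkhoff polytope; initial forms are
free for monotone circuits over `ℝ≥0` and multiplicative.  This is ALREADY A TREE THEOREM
(`ZeroOneTransfer.Negative.complexity_topComponent_le`, `topComponent_mul`, p74859; TRIAGE-r1-1 N1),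
so — unlike the sibling skeleton — it is IMPORTED here, not re-stubbed.

1. `stub_torus` (step 0 of the card): the `2n` lineality directions (row / column indicator weights)
   keep `per_n` intact and slice `h`; WLOG `h` is torus-homogeneous (all monomials share row sums
   and column sums), at no cost in either complexity.
2. `stub_noCheapOmnipresence` (K2 of the card, THE OPEN STUB): every quasi-polynomially cheap,
   nonzero, torus-homogeneous `h` admits a PLACEMENT of the block arsenal
   `G(b,k) ⊕ M₀` (= `K_{b,b}` with every edge subdivided by `2k` new vertices, padded by a perfect
   matching; `b ≥ (log₂ n + d)^d`, `k, m` free) and a weight `w` cutting out exactly that face of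
   `B_n`, such that the top-`w` fibre of `h` has a SINGLE `G`-part `u` (card: "bottom fibre with a
   single `G`-part"; failure = a `G`-circulation in the fibre, of length ≥ girth `= 8k+4`).
3. `stub_faceDescent` (the lever, card `FaceDescent`): then `top_w(per·h) = per_G · top_w(h)`,
   and substituting `1` off `G` (a free projection) leaves `per_G · a·x^u`, so
   `L(x^u · per_G) ≤ L(per·h) + 1`.
4. `stub_jssContraction` (the JSS endpoint, card K1'): a monomial cofactor helps at most
   quadratically — Jukna–Seiwert–Sergeev, contraction lemma (Jukna 2023 L.6.16 + Claim 6.18,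
   Rem 6.19; JuknaSeiwertSergeev2022 Lemma 2), stated RAW: `L(f) ≤ ((n+2)(L(x^u f)+2))^κ`.
5. `stub_blockArsenal` (card's unconditional arsenal): `per_b` is a projection of
   `per_{G(b,k)⊕M₀}` (phase bijection `PM(G(b,k)) ↔ S_b`), hence by Jerrum–Snir-by-support
   (`Negative.PerSupportBound.two_pow_le_complexity_of_support_eq_perPoly`, p75658: `2^{b/3}`)
   the placed face beats `((n+2)(2^{(log₂ n+c)^c}+3))^κ` once `b ≥ (log₂ n + d)^d`, `d = d(c,κ)`.

Composition `PerDivisionHard_of` (sorry-free, pure logic + one monotonicity step): given `c`,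
take `κ` (4), `d, n₁` (5 at `c, κ`), `n₀` (2 at `c, d`); for `n ≥ n₀ + n₁` and `h ≠ 0` with
`L(per h) + L(h) ≤ 2^B`: torus step `h ↦ h'` (1), `L(h') ≤ 2^B`, so (2) places `G` with a single
`G`-part `u`; (3) gives `L(x^u per_G) ≤ 2^B + 1`; (4) gives `L(per_G) ≤ ((n+2)(2^B+3))^κ`;
(5) says the opposite strict inequality. Contradiction.

## Disproof.lean obligations honoured (cdisprove v2, 2026-08-16T01:32)
* `perDivisionHard_false_without_nonzero`: `h ≠ 0` enters at `stub_torus` (top components of a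
  nonzero polynomial are nonzero) and at `stub_faceDescent` (the coefficient `a` of `x^u` is `≠ 0`).
* `not_perDivisionHardOver_of_charTwo` / `_zmod2` (no-cancellation is load-bearing): used by the
  imported `topComponent_mul` / `complexity_topComponent_le` (false over `𝔽₂`: sum gates cancel),
  inside `stub_torus`, `stub_faceDescent`, and in `stub_jssContraction` (gcd of supports is additive
  under products only without zero divisors / cancellation).
* `perDivisionHard_false_without_threshold`, `perDivisionHard_false_uniform`: every asymptotic stub
  has its own `n₀(c, ·)`; nothing is uniform in `c`.
* tightness `not_perDivisionHardFactorialRate`: the line proves `2^{b/3}`-type bounds with `b`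
  polylog — inside the window.
* floor (`sq_le_of_pair`, rungs `c = 0, 1`) and Boolean shadow (`shadow_perPoly_mul_iff`,
  `shadow_perPoly_mul_prod_X_iff`): not used; the line never passes to the Boolean shadow — the
  disprover's open family `∏_i (Σ_j x_ij)^a` (VERDICT item 4) dies at `stub_torus` (its torus-top is
  the monomial `∏_i x_{i j*}^a`), `h = ∏ x_ij` is a monomial (single `G`-part trivially).
* near-miss `not_perDivisionHard_imp_per_quasipoly_io`: consistent — the one open stub speaks about
  cheap `h` alone.
The landed `Negative/` files are imported above so that elaboration re-checks that no stub is an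
instance they refute (none is: they concern `h = 0`, `n ≤ 1`, uniform `n₀`, char 2, factorial rate).

## Triage sharpenings acted on
N1 (import, do not re-stub, the envelope lemma) · N3 (the endpoint is stated for the CONCRETE block
graph, whose perfect matching exists by construction — no vacuous `per_G = 0` instance; and the
face condition `CutsOut` forces a perfect matching inside `G`) · N4/F3 (endpoint = JSS contraction
Lemma 2 / Jukna L.6.16, not HY21 Prop 43(3); degree-robust since gcd vectors are `2^s`-bounded) ·
F1/App. B (K2 needs no per-power exception: `per^M` is never cheap) · r1-2 "n₀(c) ≥ 2^{c²}":
absorbed in the `∃ n₀` of stubs 2 and 5 · r1-3 (k may be taken up to `(n-b)/b²`: `k` is free in K2).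
-/

noncomputable section

set_option linter.dupNamespace false

namespace Summit.ValiantsHypothesis.ValiantsHypothesis.Cruxes.PerDivisionHard.PairDescentJssEndpoint

open MvPolynomial Literature.Computability.AlgebraicComplexity
open Summit.ValiantsHypothesis.ValiantsHypothesis.Theorems.ZeroOneTransfer.Negative (topComponent)
open scoped NNReal BigOperators

/-! ### Local vocabulary (transparent definitions over Mathlib / tree notions) -/

/-- Torus homogeneity: all monomials of `h` have the same row margins and the same column margins
(`h` is a semi-invariant of `x_ij ↦ s_i t_j x_ij`).  Same text as the sibling line's notion. -/
def IsTorusHomogeneous {n : ℕ} (h : MvPolynomial (Fin n × Fin n) ℝ≥0) : Prop :=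
  ∃ r c : Fin n →₀ ℕ, ∀ m ∈ h.support, rowDegrees m = r ∧ Finsupp.mapDomain Prod.snd m = c

/-- The face permanent `per_G`: the sum of the permutation monomials `x^{μ_σ}`,
`μ_σ = Σ_i e_{(σ i, i)}` (the tree's `permMonomial`, as in `perPoly_eq_sum_monomial`), over the
permutations lying inside the edge set `G ⊆ [n] × [n]` — the face `F_G` of the Birkhoff polytope. -/
def facePer {n : ℕ} (G : Finset (Fin n × Fin n)) : MvPolynomial (Fin n × Fin n) ℝ≥0 :=
  ∑ σ ∈ (Finset.univ : Finset (Equiv.Perm (Fin n))).filter (fun σ => ∀ i, (σ i, i) ∈ G),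
    monomial (permMonomial σ) (1 : ℝ≥0)

/-- `w` CUTS OUT the face `G`: a permutation lies inside `G` iff its `w`-weight `Σ_i w(σ i, i)` is
maximal.  Exactly the condition under which `top_w(per_n) = facePer G` (it forces a perfect
matching inside `G`).  Realised e.g. by `w = W` on `G`, `w < W` off `G` when `G` has a perfect
matching; for torus-homogeneous `h` the top-`w` fibre of `h` is then the card's `p`-BOTTOM fibre,
`p = W - w > 0` off `G`. -/
def CutsOut {n : ℕ} (w : Fin n × Fin n → ℕ) (G : Finset (Fin n × Fin n)) : Prop :=
  ∀ σ : Equiv.Perm (Fin n),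
    (∀ i, (σ i, i) ∈ G) ↔ ∀ τ : Equiv.Perm (Fin n), (∑ i, w (τ i, i)) ≤ ∑ i, w (σ i, i)

/-- The top-`w` fibre of `h` has the SINGLE `G`-part `u`: `u` is supported in `G` and every monomial
of `top_w h` restricts to `u` on `G` (monomials may differ OFF `G`; substituting `1` there collapses
the fibre to `a · x^u`, `a ≠ 0`). -/
def HasSingleGPart {n : ℕ} (G : Finset (Fin n × Fin n)) (w : Fin n × Fin n → ℕ)
    (h : MvPolynomial (Fin n × Fin n) ℝ≥0) (u : (Fin n × Fin n) →₀ ℕ) : Prop :=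
  u.support ⊆ G ∧ ∀ m ∈ (topComponent w h).support, ∀ e ∈ G, m e = u e

/-- Vertex labels of the block arsenal `G(b,k) ⊕ M₀` (used for rows AND for columns):
`b` core vertices, `b·b·k` internal vertices `(i, j, t)` of the subdivided edge `(i, j)`, and `m`
padding vertices. -/
abbrev BlockV (b k m : ℕ) : Type := Fin b ⊕ ((Fin b × Fin b × Fin k) ⊕ Fin m)

/-- Adjacency (row vertex, column vertex) of `G(b,k) ⊕ M₀`.  The core edge `(i, j)` of `K_{b,b}`
becomes the path  row `i` — col `(i,j,0)` — row `(i,j,0)` — col `(i,j,1)` — … — row `(i,j,k-1)` —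
col `j`  with `2k` internal vertices and `2k+1` edges (for `k = 0`: the edge `(i, j)` itself);
padding vertex `t` is matched to padding vertex `t` only.  Perfect matchings ↔ `S_b` (a path is
traversed in one of its two phases), girth `4(2k+1)` for `b ≥ 2`. -/
def blockAdj (b k m : ℕ) : BlockV b k m → BlockV b k m → Bool
  | Sum.inl _, Sum.inl _ => decide (k = 0)
  | Sum.inl i, Sum.inr (Sum.inl ⟨i', _, t⟩) => decide (i = i' ∧ (t : ℕ) = 0)
  | Sum.inr (Sum.inl ⟨i, j, t⟩), Sum.inr (Sum.inl ⟨i', j', t'⟩) =>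
      decide (i = i' ∧ j = j' ∧ ((t' : ℕ) = t ∨ (t' : ℕ) = t + 1))
  | Sum.inr (Sum.inl ⟨_, j, t⟩), Sum.inl j' => decide (j = j' ∧ (t : ℕ) + 1 = k)
  | Sum.inr (Sum.inr t), Sum.inr (Sum.inr t') => decide (t = t')
  | _, _ => false

/-- The PLACED block graph: rows and columns of the `n × n` matrix are labelled by `BlockV b k m`
through the placements `eR`, `eC` (so `n = b + b²k + m`). -/
def placedBlock {b k m n : ℕ} (eR eC : BlockV b k m ≃ Fin n) : Finset (Fin n × Fin n) :=
  Finset.univ.filter fun e => blockAdj b k m (eR.symm e.1) (eC.symm e.2) = true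

/-! ### Registered stubs -/

/-- **stub_torus (card step 0; provable now, size M).**  `per_n` is weighted-homogeneous of degree
`1` for each of the `2n` row / column indicator weights, so `top_w(per · h) = per · top_w(h)`
(`topComponent_mul`, `topComponent_eq_self_of_isWeightedHomogeneous`); iterating `h ↦ top_w h`
over the `2n` weights keeps `h ≠ 0` (`topComponent_ne_zero`), selects sub-supports
(`support_topComponent_subset`, so earlier homogeneities survive), and never increases either
complexity (`complexity_topComponent_le`).  The end result is torus-homogeneous.  Signature
identical to the sibling line's `stub_torus` (one proof serves both). -/
theorem stub_torus :
    ∀ (n : ℕ) (h : MvPolynomial (Fin n × Fin n) ℝ≥0), h ≠ 0 →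
      ∃ h' : MvPolynomial (Fin n × Fin n) ℝ≥0, h' ≠ 0 ∧ IsTorusHomogeneous h' ∧
        complexity (perPoly (Fin n) ℝ≥0 * h') ≤ complexity (perPoly (Fin n) ℝ≥0 * h) ∧
        complexity h' ≤ complexity h := by
  sorry

/-- **stub_faceDescent (the lever `FaceDescent` of the card; provable now, size M).**  If `w` cuts
out `G` then `top_w(per_n) = facePer G` (`perPoly_eq_sum_monomial`; the weight of `x^{μ_σ}` is
`Σ_i w(σ i, i)`), hence `top_w(per_n · h) = facePer G · top_w h` (`topComponent_mul`) at complexity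
`≤ L(per_n · h)` (`complexity_topComponent_le`).  The projection `x_e ↦ 1` (`e ∉ G`), `x_e ↦ x_e`
(`e ∈ G`) fixes `facePer G` and maps `top_w h` to `a · x^u`, `a = Σ coeff ≠ 0` (single `G`-part,
`h ≠ 0`); projections are free (`IsProjection.complexity_le_holds`) and the rescaling by `a⁻¹`
costs one gate (`complexity_smul_le_holds`). -/
theorem stub_faceDescent :
    ∀ (n : ℕ) (G : Finset (Fin n × Fin n)) (w : Fin n × Fin n → ℕ)
      (h : MvPolynomial (Fin n × Fin n) ℝ≥0) (u : (Fin n × Fin n) →₀ ℕ),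
      CutsOut w G → h ≠ 0 → HasSingleGPart G w h u →
      complexity (monomial u (1 : ℝ≥0) * facePer G) ≤
        complexity (perPoly (Fin n) ℝ≥0 * h) + 1 := by
  sorry

/-- **stub_jssContraction (the JSS endpoint, card K1'; literature vendoring, size L).**
Jukna–Seiwert–Sergeev: if `x^u · f` has a monotone fan-in-two circuit of size `s` over `ℝ≥0` in
`N = n²` variables, then `f` has one of size `O(N s²)`: carry the contraction `[g] = g / x^{gcd g}`
gate by gate (sum gate: `gcd = min`, re-multiply the two operands by `2^s`-bounded monomials;
product gate: `gcd` adds, nothing to do — Jukna 2023 Claim 6.17), produce each bounded monomial by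
repeated squaring (`O(N s)` gates, Claim 6.18), note `[x^u f] = [f]` and `f = x^{gcd f} · [f]`
(Jukna 2023 L.6.16, Rem 6.19 for the arithmetic semiring; JuknaSeiwertSergeev2022 Lemma 2).
Weighted sum gates: plainify first (`Negative/PlainBridge.exists_plain_of_computes`, factor ≤ 3).
RAW polynomial form (the constant and `N = n²` absorbed in `κ`); `f = 0` and constants are free. -/
theorem stub_jssContraction :
    ∃ κ : ℕ, ∀ (n : ℕ) (f : MvPolynomial (Fin n × Fin n) ℝ≥0) (u : (Fin n × Fin n) →₀ ℕ),
      complexity f ≤ ((n + 2) * (complexity (monomial u (1 : ℝ≥0) * f) + 2)) ^ κ := by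
  sorry

/-- **stub_blockArsenal (the unconditional arsenal of the card; provable now, size M).**
(i) Phase bijection: the perfect matchings of `G(b,k) ⊕ M₀` are in bijection with `S_b` (a core row
`i` is matched into exactly one path `(i, j)`, which is then traversed in its "used" phase, all
other paths in their "unused" phase; padding is forced), so the projection
`x_{(i, (i,j,0))} ↦ X (i, j)` (for `k = 0`: `x_{(i,j)} ↦ X (i,j)`), every other variable `↦ 1`,
maps `facePer (placedBlock eR eC)` onto `perPoly (Fin b) ℝ≥0` (after `rename` along `eR/eC`);
projections are free (`IsProjection.complexity_le_holds`).  (ii) `2^{b/3} ≤ L(per_b)` for `b ≥ 6`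
(`Negative.PerSupportBound.two_pow_le_complexity_of_support_eq_perPoly`, or Jerrum–Snir through
`Negative/PlainBridge.js_le_two_mul_complexity_perPoly`).  (iii) Arithmetic: with
`B = (log₂ n + c)^c`, `((n+2)(2^B+3))^κ ≤ 2^{κ(B + log₂ n + 4)} < 2^{b/3}` as soon as
`b ≥ (log₂ n + d)^d`, `d = c + 3κ + 7`, `n ≥ 2`.  (`b ≤ n` is forced by the placements.) -/
theorem stub_blockArsenal :
    ∀ c κ : ℕ, ∃ d n₁ : ℕ, ∀ n ≥ n₁, ∀ (b k m : ℕ) (eR eC : BlockV b k m ≃ Fin n),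
      (Nat.log 2 n + d) ^ d ≤ b →
      ((n + 2) * (2 ^ ((Nat.log 2 n + c) ^ c) + 3)) ^ κ <
        complexity (facePer (placedBlock eR eC)) := by
  sorry

/-- **stub_noCheapOmnipresence (K2 of the card = RigidHardFace of the merged line; OPEN, the
hardest, load-bearing stub; size XL).**  For every `c, d` and all large `n`: every nonzero
torus-homogeneous `h` of complexity `≤ 2^{(log₂ n + c)^c}` admits a placement `eR, eC` of some
`G(b,k) ⊕ M₀` with `b ≥ (log₂ n + d)^d` (`k`, `m` at the prover's disposal, `b + b²k + m = n`;
`k` up to `(n-b)/b²` gives girth up to `n/polylog`), a weight `w` cutting out that face, and a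
`G`-part `u` shared by the whole top-`w` fibre of `h`.  A statement about `h` ALONE.
Mechanism offered by the card: take `w = W·𝟙_G + (W - p)·𝟙_{Gᶜ}` with `p > 0` generic off `G`;
for torus-homogeneous `h` two fibre monomials with different `G`-parts then differ by a nonzero
integer CIRCULATION of `G`, whose support contains a cycle of `G`, of length `≥ 8k+4`; so only
cofactors carrying such long balanced exchanges on EVERY placement escape ("omnipresent" `h`),
and the bet is that omnipresence at girth polylog is unaffordable at quasi-polynomial size
(cycle products `U_ℓ` need `ℓ ≥ 8k+4` factors' worth, `n^{Θ(ℓ)}`; per-like supports cost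
`≥ C(n,⌈n/3⌉)` by the typed-vertex bound, TRIAGE F1).  Verified by hand / kit on every cheap family
named in round 1 (TRIAGE-r1-2 F5, r1-3 App. C).  WHY IT MIGHT FAIL: a cheap NON-product `h` with
implicitly exponentially many long balanced exchange pairs hitting every placement (e.g. sums over
a cheap permutation group with long cycles at all scales); the naive union bound needs
`girth · log n ≳ log L(h)` and is unproved in general.  Degenerate instances are fine: constants and
monomials have a one-monomial fibre; `per^M`, `per(x^{∘v})` are not cheap. -/
theorem stub_noCheapOmnipresence :
    ∀ c d : ℕ, ∃ n₀ : ℕ, ∀ n ≥ n₀, ∀ h : MvPolynomial (Fin n × Fin n) ℝ≥0,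
      h ≠ 0 → IsTorusHomogeneous h → complexity h ≤ 2 ^ ((Nat.log 2 n + c) ^ c) →
      ∃ (b k m : ℕ) (eR eC : BlockV b k m ≃ Fin n) (w : Fin n × Fin n → ℕ)
        (u : (Fin n × Fin n) →₀ ℕ),
        (Nat.log 2 n + d) ^ d ≤ b ∧ CutsOut w (placedBlock eR eC) ∧
          HasSingleGPart (placedBlock eR eC) w h u := by
  sorry

/-! ### The kernel-checked composition -/

/-- **Composition (audited skeleton theorem).**  Concludes the crux `DivisionGap.PerDivisionHard`
BY NAME from exactly the five registered stubs, invoked by name; no `sorry` of its own; pure logic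
plus one monotonicity step (`((n+2)(s+2))^κ` is monotone in `s`). -/
theorem PerDivisionHard_of :
    Summit.ValiantsHypothesis.ValiantsHypothesis.Theses.DivisionGap.PerDivisionHard := by
  intro c
  obtain ⟨κ, hcon⟩ := stub_jssContraction
  obtain ⟨d, n₁, hhard⟩ := stub_blockArsenal c κ
  obtain ⟨n₀, hK2⟩ := stub_noCheapOmnipresence c d
  refine ⟨n₀ + n₁, ?_⟩
  intro n hn h hh
  obtain ⟨h', hh', htor, hle1, hle2⟩ := stub_torus n h hh
  by_contra hlt
  have hle : complexity (perPoly (Fin n) ℝ≥0 * h) + complexity h ≤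
      2 ^ ((Nat.log 2 n + c) ^ c) := not_lt.mp hlt
  -- the pair is cheap, hence so is the torus normal form `h'`
  have hcheap : complexity h' ≤ 2 ^ ((Nat.log 2 n + c) ^ c) :=
    le_trans hle2 (le_trans (Nat.le_add_left _ _) hle)
  -- K2: place a hard block face on which the top fibre of `h'` has a single `G`-part
  obtain ⟨b, k, m, eR, eC, w, u, hb, hcut, hsingle⟩ := hK2 n (by omega) h' hh' htor hcheap
  -- face descent: `x^u · per_G` is (up to one gate) no more expensive than `per · h'`
  have hdesc := stub_faceDescent n (placedBlock eR eC) w h' u hcut hh' hsingle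
  have h1 : complexity (monomial u (1 : ℝ≥0) * facePer (placedBlock eR eC)) ≤
      2 ^ ((Nat.log 2 n + c) ^ c) + 1 :=
    calc complexity (monomial u (1 : ℝ≥0) * facePer (placedBlock eR eC))
        ≤ complexity (perPoly (Fin n) ℝ≥0 * h') + 1 := hdesc
      _ ≤ complexity (perPoly (Fin n) ℝ≥0 * h) + 1 := Nat.add_le_add_right hle1 1
      _ ≤ 2 ^ ((Nat.log 2 n + c) ^ c) + 1 :=
          Nat.add_le_add_right (le_trans (Nat.le_add_right _ _) hle) 1
  -- JSS contraction: strip the monomial at polynomial cost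
  have h2 : complexity (facePer (placedBlock eR eC)) ≤
      ((n + 2) * (2 ^ ((Nat.log 2 n + c) ^ c) + 3)) ^ κ :=
    calc complexity (facePer (placedBlock eR eC))
        ≤ ((n + 2) * (complexity (monomial u (1 : ℝ≥0) * facePer (placedBlock eR eC)) + 2)) ^ κ :=
          hcon n (facePer (placedBlock eR eC)) u
      _ ≤ ((n + 2) * (2 ^ ((Nat.log 2 n + c) ^ c) + 3)) ^ κ :=
          Nat.pow_le_pow_left (Nat.mul_le_mul_left _ (by omega)) κ
  -- the placed block face is harder than that
  have h3 := hhard n (by omega) b k m eR eC hb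
  exact absurd (lt_of_lt_of_le h3 h2) (lt_irrefl _)

end Summit.ValiantsHypothesis.ValiantsHypothesis.Cruxes.PerDivisionHard.PairDescentJssEndpoint

end
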